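import Literature.MathematicalPhysics.QuantumLattice.WilsonDiracGaussianRepresentation
import HarnessLib

/-!
# LatticeQCDFlow / Scaling — the one-flavour reweighting estimator has FINITE variance at every
# step size in the direction of decreasing mass

HONEST FRAMING: exact (Metropolis-corrected) sampling algorithms for lattice gauge theory;
figures of merit are autocorrelation/cost numbers at stated couplings and volumes; no
continuum-physics claim.

Venture `LatticeQCDFlow` (cell pub-lqcd), topic `Scaling`; landed by FANOUT row 38 (r2-scope) next to
HOME/R2-SCOPE.md §3 E2 D1/D2 and §4 C-PM (determinant-ratio estimators with Gaussian noise; "the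
single-draw noise is the lever").  NEW WORK of the cell — an elementary consequence of three PUBLISHED
results that are tree theorems:

* Finkenrath–Knechtli–Leder, Nucl. Phys. B 877 (2013) 441, §2.1 (2.3)–(2.4): the single-noise Gaussian
  estimate `W_M(η) = e^{−η†(M−I)η}` of `1/det M` has variance
  `σ_η² = 1/det(M + M† − I) − 1/det(MM†)`, finite iff `λ(M + M†) > 1`
  (`Literature…StochasticDeterminant.variance_detInvEst'`, `integrable_gaussian_mul_sq_norm_detInvEst_iff`);
  §2.2: the one-flavour factor is `W = 1/det M`, `M⁻¹ = D_m⁻¹D_{m'}`, i.e. `M = I + Δm·D_{m'}⁻¹` with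
  `Δm = m − m'` (`shifted_inv_mul_shifted'`); the paper only says "the integral representation of
  `W` … exists for sufficiently small `Δm`" and interpolates `m → m'` in `N` steps (§2.3) so that
  "convergence can be assured by choosing `N` large enough".
* Horn–Johnson 7.1.P21 (f): `λ(A + A†) > 0 ⟹ λ(A⁻¹ + A⁻¹†) > 0`
  (`Literature…StochasticDeterminant.posDef_inv_add_conjTranspose`).
* Montvay–Münster §7.4: the Wilson–Dirac operator `D_W(U, m)` (`r = 1`, unitary `ρ`) has positive
  definite Hermitian part at every gauge field for `m > 0`, `|K| < 1/8`
  (`Literature…QuantumLattice.posDef_wilsonDirac_add_conjTranspose`).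

Consequence proved here (not stated in the sources in this form): the SIGN of `Δm` decides.
If `Δm = m − m' ≥ 0` — reweighting towards the LIGHTER mass `m'` — and `D_{m'}` has positive definite
Hermitian part, then `M = I + Δm·D_{m'}⁻¹` has Hermitian part `≥ I`, so `λ(M + M†) ≥ 2 > 1` and the
variance condition (2.4) holds for EVERY `Δm ≥ 0`, with no interpolation at all; each interpolation
step `m_l → m_{l+1} = m_l − δm` (`δm ≥ 0`) satisfies it likewise.  Mass interpolation is then a
variance-REDUCTION device ((2.10): `δ_η² ≈ Δm² Tr(…)/(N N_η)`), not a convergence requirement.  In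
the opposite direction (`Δm < 0`) nothing of the kind holds and the printed "sufficiently small `Δm`"
is the operative condition.  For Wilson fermions the hypothesis is `m' > 0` (`κ' < 1/8`), at every
gauge field.

Results:
* `posDef_hermPart_one_add_smul_of_nonneg` — `(A + A†).PosDef`, `0 ≤ δ` ⟹ for `M = I + δ·A⁻¹`:
  `(M + M† − I).PosDef` (FKL's (2.4)) and `(M + M†).PosDef` (FKL's (2.1));
* `posDef_shifted_add_conjTranspose_of_le` — `λ(D_μ + D_μ†) > 0` is monotone in the shift `μ`;
* `posDef_ratio_variance_condition` — for `D_μ = D + μ`, `μ' ≤ μ`, `λ(D_{μ'} + D_{μ'}†) > 0`: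
  the ratio `M = D_{μ'}⁻¹ D_μ` satisfies `(M + M† − I).PosDef`; hence (`variance_ratio_finite`) FKL's
  variance identity (2.3) holds for it with both determinants non-zero;
* `wilsonDirac_eq_add_smul` — `D_W(U, m) = D_W(U, m') + (m − m')·1`;
* `posDef_wilsonRatio_variance_condition` — the Wilson instance: `0 < m' ≤ m` ⟹ the one-flavour
  ratio `M = D_W(U, m')⁻¹ D_W(U, m)` meets (2.4) at EVERY gauge field `U`.
-/

namespace Summit.Ventures.LatticeQCDFlow.Scaling

open Matrix Complex
open Literature.Probability.LatticeModels (TorusSite)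
open Literature.MathematicalPhysics.QuantumFieldTheory
open Literature.MathematicalPhysics.QuantumFieldTheory.StochasticDeterminant
open Literature.MathematicalPhysics.QuantumLattice
open scoped BigOperators ComplexOrder ComplexConjugate

section Abstract

variable {ι : Type} [Fintype ι] [DecidableEq ι]

/-- **The sign lemma.**  If `A` has positive definite Hermitian part and `δ ≥ 0`, then
`M = I + δ·A⁻¹` has Hermitian part `≥ I`: both `M + M† − I` (Finkenrath–Knechtli–Leder's variance
condition (2.4), `λ(M + M†) > 1`) and `M + M†` (their (2.1)) are positive definite.  From
Horn–Johnson 7.1.P21 (f) (`posDef_inv_add_conjTranspose`): `M + M† − I = I + δ(A⁻¹ + A⁻¹†)`.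
[folklore] -/
theorem posDef_hermPart_one_add_smul_of_nonneg {A : Matrix ι ι ℂ} (hA : (A + Aᴴ).PosDef) {δ : ℝ}
    (hδ : 0 ≤ δ) :
    ((1 + (δ : ℂ) • A⁻¹) + (1 + (δ : ℂ) • A⁻¹)ᴴ - 1).PosDef := by
  have hinv := posDef_inv_add_conjTranspose hA
  have hkey : (1 + (δ : ℂ) • A⁻¹) + (1 + (δ : ℂ) • A⁻¹)ᴴ - 1 =
      1 + (δ : ℂ) • (A⁻¹ + A⁻¹ᴴ) := by
    rw [conjTranspose_add, conjTranspose_one, conjTranspose_smul, Complex.star_def,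
      Complex.conj_ofReal, smul_add]
    abel
  rw [hkey]
  refine PosDef.of_dotProduct_mulVec_pos ?_ fun x hx => ?_
  · have h1 : (A⁻¹ + A⁻¹ᴴ).IsHermitian := hinv.isHermitian
    unfold Matrix.IsHermitian at h1 ⊢
    rw [conjTranspose_add, conjTranspose_one, conjTranspose_smul, Complex.star_def,
      Complex.conj_ofReal, h1]
  · rw [add_mulVec, one_mulVec, dotProduct_add, smul_mulVec, dotProduct_smul, smul_eq_mul]
    have hq : 0 < star x ⬝ᵥ ((A⁻¹ + A⁻¹ᴴ) *ᵥ x) := hinv.dotProduct_mulVec_pos hx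
    have hxx : 0 < star x ⬝ᵥ x := by
      have := (PosDef.one (n := ι) (R := ℂ)).dotProduct_mulVec_pos hx
      rwa [one_mulVec] at this
    have hδq : 0 ≤ (δ : ℂ) * (star x ⬝ᵥ ((A⁻¹ + A⁻¹ᴴ) *ᵥ x)) :=
      mul_nonneg (Complex.zero_le_real.mpr hδ) hq.le
    exact add_pos_of_pos_of_nonneg hxx hδq

/-- Under the same hypotheses `M + M†` is positive definite too ((2.1) for `M`: the mean
`⟨W_M⟩ = 1/det M` exists). [folklore] -/
theorem posDef_add_conjTranspose_one_add_smul_of_nonneg {A : Matrix ι ι ℂ} (hA : (A + Aᴴ).PosDef)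
    {δ : ℝ} (hδ : 0 ≤ δ) :
    ((1 + (δ : ℂ) • A⁻¹) + (1 + (δ : ℂ) • A⁻¹)ᴴ).PosDef := by
  have h := (posDef_hermPart_one_add_smul_of_nonneg hA hδ).add_posSemidef PosSemidef.one
  rwa [sub_add_cancel] at h

/-- **Monotonicity of the hypothesis in the mass shift**: if `D + μ₀` has positive definite Hermitian
part then so does `D + μ` for every `μ ≥ μ₀` (`D_μ = D_{μ₀} + (μ − μ₀)·I`). [folklore] -/
theorem posDef_shifted_add_conjTranspose_of_le (D : Matrix ι ι ℂ) {μ₀ μ : ℝ} (hμ : μ₀ ≤ μ)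
    (h0 : ((D + (μ₀ : ℂ) • 1) + (D + (μ₀ : ℂ) • 1)ᴴ).PosDef) :
    ((D + (μ : ℂ) • 1) + (D + (μ : ℂ) • 1)ᴴ).PosDef := by
  rw [posDef_add_conjTranspose_iff_forall_re_pos] at h0 ⊢
  intro v hv
  have hsplit : D + (μ : ℂ) • (1 : Matrix ι ι ℂ) = (D + (μ₀ : ℂ) • 1) + ((μ - μ₀ : ℝ) : ℂ) • 1 := by
    push_cast
    module
  have hvv : 0 < (star v ⬝ᵥ v).re := by
    have hne : star v ⬝ᵥ v ≠ 0 := fun h => hv (dotProduct_star_self_eq_zero.mp h)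
    have hnn : 0 ≤ star v ⬝ᵥ v := dotProduct_star_self_nonneg v
    rcases hnn.lt_or_eq with hlt | heq
    · exact (Complex.lt_def.mp hlt).1
    · exact absurd heq.symm hne
  rw [hsplit, add_mulVec, dotProduct_add, Complex.add_re, smul_mulVec, one_mulVec, dotProduct_smul,
    smul_eq_mul, Complex.re_ofReal_mul]
  have := h0 v hv
  nlinarith

/-- **The one-flavour ratio towards the lighter mass meets the variance condition at every step
size.**  For the shifted operators `D_μ = D + μ` with `λ(D_{μ'} + D_{μ'}†) > 0` and `μ' ≤ μ`, the
ratio `M = D_{μ'}⁻¹ D_μ` (`= I + (μ − μ')·D_{μ'}⁻¹`, FKL §2.2 with `m = μ`, `m' = μ'`,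
`Δm = μ − μ' ≥ 0`) satisfies Finkenrath–Knechtli–Leder's (2.4): `M + M† − I` is positive definite.
[folklore] -/
theorem posDef_ratio_variance_condition (D : Matrix ι ι ℂ) {μ μ' : ℝ} (hle : μ' ≤ μ)
    (h' : ((D + (μ' : ℂ) • 1) + (D + (μ' : ℂ) • 1)ᴴ).PosDef) :
    ((D + (μ' : ℂ) • 1)⁻¹ * (D + (μ : ℂ) • 1) + ((D + (μ' : ℂ) • 1)⁻¹ * (D + (μ : ℂ) • 1))ᴴ
      - 1).PosDef := by
  rw [shifted_inv_mul_shifted' D μ μ' (det_ne_zero_of_posDef_add_conjTranspose h')]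
  exact posDef_hermPart_one_add_smul_of_nonneg h' (sub_nonneg.mpr hle)

/-- Hence FKL's variance identity (2.3) APPLIES to that ratio, with every quantity finite:
`σ_η²(W_M) = 1/det(M + M† − I) − 1/|det M|²` for `M = D_{μ'}⁻¹D_μ`, `μ' ≤ μ`, at the single
hypothesis `λ(D_{μ'} + D_{μ'}†) > 0` (no "sufficiently small `Δm`", no interpolation).
[folklore] -/
theorem variance_ratio_finite (D : Matrix ι ι ℂ) {μ μ' : ℝ} (hle : μ' ≤ μ)
    (h' : ((D + (μ' : ℂ) • 1) + (D + (μ' : ℂ) • 1)ᴴ).PosDef) :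
    let M := (D + (μ' : ℂ) • 1)⁻¹ * (D + (μ : ℂ) • 1)
    (Real.pi ^ Fintype.card ι)⁻¹ *
        (∫ η : ι → ℂ, Real.exp (-(∑ i, ‖η i‖ ^ 2)) * ‖cexp (-(star η ⬝ᵥ ((M - 1) *ᵥ η)))‖ ^ 2)
      - ‖((Real.pi : ℂ) ^ Fintype.card ι)⁻¹ *
          ∫ η : ι → ℂ, (Real.exp (-(∑ i, ‖η i‖ ^ 2)) : ℂ) * cexp (-(star η ⬝ᵥ ((M - 1) *ᵥ η)))‖ ^ 2
      = 1 / ((M + Mᴴ - 1).det).re - 1 / ‖M.det‖ ^ 2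
      ∧ 0 < ((M + Mᴴ - 1).det).re ∧ M.det ≠ 0 := by
  intro M
  have hM : (M + Mᴴ - 1).PosDef := posDef_ratio_variance_condition D hle h'
  have hM0 : (M + Mᴴ).PosDef := by
    have h := hM.add_posSemidef PosSemidef.one
    rwa [sub_add_cancel] at h
  exact ⟨variance_detInvEst_real hM, (Complex.lt_def.mp hM.det_pos).1,
    det_ne_zero_of_posDef_add_conjTranspose hM0⟩

end Abstract

/-! ## The Wilson instance -/

section Wilson

variable {L N : ℕ} [NeZero L] {G : Type*} [Group G] (ρ : G →* Matrix (Fin N) (Fin N) ℂ)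

omit [NeZero L] in
/-- The mass enters the Wilson–Dirac operator only on the diagonal:
`D_W(U, m) = D_W(U, m') + (m − m')·1`. [folklore] -/
theorem wilsonDirac_eq_add_smul (U : GaugeConfig 4 L G) (m m' r : ℝ) :
    wilsonDirac ρ U m r = wilsonDirac ρ U m' r + ((m - m' : ℝ) : ℂ) • 1 := by
  ext p q
  rw [Matrix.add_apply, Matrix.smul_apply, Matrix.one_apply, smul_eq_mul, mul_ite, mul_one, mul_zero,
    ← sub_eq_iff_eq_add']
  -- the hopping part does not depend on the mass and cancels
  simp only [wilsonDirac, Matrix.of_apply]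
  rw [sub_sub_sub_cancel_right]
  split_ifs <;> push_cast <;> ring

/-- **Wilson fermions, one-flavour reweighting towards the lighter quark mass**: for `r = 1`,
unitary `ρ`, masses `0 < m' ≤ m` (both hopping parameters below `1/8`) and EVERY gauge field `U`,
the ratio `M = D_W(U, m')⁻¹ D_W(U, m)` of Finkenrath–Knechtli–Leder §2.2 satisfies their variance
condition (2.4), `M + M† − I` positive definite — so the single-noise Gaussian estimator of the
reweighting factor `W = 1/det M` has finite variance `1/det(M + M† − I) − 1/|det M|²` for every
`Δm = m − m' ≥ 0`, without mass interpolation (which then only REDUCES the variance).  Ingredients: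
Montvay–Münster's positivity of `D_W(U, m')` (`posDef_wilsonDirac_add_conjTranspose`), Horn–Johnson
7.1.P21 (f), and `M = I + Δm·D_W(U, m')⁻¹`. [folklore] -/
theorem posDef_wilsonRatio_variance_condition (hρ : ∀ g, ρ g ∈ Matrix.unitaryGroup (Fin N) ℂ)
    (U : GaugeConfig 4 L G) {m m' : ℝ} (hm' : 0 < m') (hle : m' ≤ m) :
    ((wilsonDirac ρ U m' 1)⁻¹ * wilsonDirac ρ U m 1 +
        ((wilsonDirac ρ U m' 1)⁻¹ * wilsonDirac ρ U m 1)ᴴ - 1).PosDef := by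
  have hpos := posDef_wilsonDirac_add_conjTranspose ρ hρ U hm'
  have hdet : (wilsonDirac ρ U m' 1).det ≠ 0 := det_ne_zero_of_posDef_add_conjTranspose hpos
  have hM : (wilsonDirac ρ U m' 1)⁻¹ * wilsonDirac ρ U m 1 =
      1 + ((m - m' : ℝ) : ℂ) • (wilsonDirac ρ U m' 1)⁻¹ := by
    rw [wilsonDirac_eq_add_smul ρ U m m' 1, Matrix.mul_add, nonsing_inv_mul _ (Ne.isUnit hdet),
      Matrix.mul_smul, Matrix.mul_one]
  rw [hM]
  exact posDef_hermPart_one_add_smul_of_nonneg hpos (sub_nonneg.mpr hle)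

end Wilson

end Summit.Ventures.LatticeQCDFlow.Scaling
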